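import Summits.HodgeConjecture.HodgeConjecture.Theorems.AnchorTransportVariationalHodgePadicGrothendieckExistenceVectorBundlesWitt
import Literature.AlgebraicGeometry.Motives.GrothendieckExistenceWittProofs

/-!
# Grothendieck's existence theorem for vector bundles over `W(k)` — the remaining vendored variants hold

Row b03 / crux `AnchorTransport.VariationalHodge` (stmt-HodgeConjecture-1076), line padic-disc-transport,
STUB P. The tree vendored Görtz–Wedhorn II, Thm. 24.94 + Prop. 24.95 (Grothendieck's existence theorem
for vector bundles on a proper `W(k)`-scheme, `k` perfect of characteristic `p`) in FOUR shapes
(`Motives/GrothendieckExistenceWittProofs`, "web of vendored variants"):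

* `Motives.GrothendieckExistence_vectorBundle_witt` (level one, any universe) — a THEOREM since
  `GrothendieckExistenceProper.GrothendieckExistence_vectorBundle_witt_holds`
  (`…GrothendieckExistenceVectorBundlesWitt`);
* `FormalGeometry.GortzWedhorn2023_prop2495_wittVector` (`LiftsFormally → LiftsTo`, proper `𝒳`) — a
  THEOREM since `GrothendieckExistenceProper.GortzWedhorn2023_prop2495_wittVector_holds` (same file);
* `Deformation.GortzWedhorn2023_thm2494_vectorBundle_witt` (ALL levels, `k : Type`) — discharged HERE;
* `FormalGeometry.GortzWedhorn2023_prop_24_95_wittModel_liftsTo_of_liftsFormally` (smooth proper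
  `W(k)`-models, any universe) — discharged HERE.

Both discharges are immediate from the all-levels theorem
`GrothendieckExistenceProper.exists_isVectorBundle_forall_pullback_thickeningι_iso` (every proper
`𝒳 / W(k)`, every level, every universe) resp. from the implication
`GrothendieckExistence_vectorBundle_witt.prop_24_95_wittModel` of the web. No definition, no new named
fact, no `sorry`.

HONEST FRAMING: research route conditional on HC_CM; not a corollary; Q11.4-sentence-2 already
refuted in dim ≥ 3. Nothing here bears on `HC_CM`; no case of the Hodge conjecture is proved.

References: GortzWedhorn2023 (II: Thm. 24.94, Prop. 24.95, Lemma 24.96, pp. 566–567); EGAIII1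
(Thm. 5.1.4).
-/

set_option linter.dupNamespace false

noncomputable section

-- Summit.HodgeConjecture.HodgeConjecture.… repeats the summit name by the D-0017 layout (Sub = Summit).

open CategoryTheory CategoryTheory.Limits AlgebraicGeometry
open Literature.AlgebraicGeometry.Motives Literature.AlgebraicGeometry.Motives.WittScheme

universe u

namespace Summit.HodgeConjecture.HodgeConjecture.Theorems

namespace GrothendieckExistenceProper

/-- **`Deformation.GortzWedhorn2023_thm2494_vectorBundle_witt` is a theorem** (Görtz–Wedhorn II
Thm. 24.94 with Prop. 24.95 for finite locally free modules on a PROPER `W(k)`-scheme, `k` perfect of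
characteristic `p`, ALL levels): a compatible system `(E n)` of vector bundles on the thickenings
`𝒳 ⊗ W/pⁿ⁺¹` is `(F|_{X_{n+1}})_n` for a vector bundle `F` on `𝒳`. One line from
`exists_isVectorBundle_forall_pullback_thickeningι_iso` (isomorphisms reversed). -/
theorem GortzWedhorn2023_thm2494_vectorBundle_witt_holds :
    Literature.AlgebraicGeometry.Deformation.GortzWedhorn2023_thm2494_vectorBundle_witt := by
  intro p _ k _ _ _ 𝒳 h𝒳 E hE hstep
  haveI := h𝒳
  obtain ⟨F, hF, e⟩ := exists_isVectorBundle_forall_pullback_thickeningι_iso 𝒳 E hE hstep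
  exact ⟨F, hF, fun n => ⟨(e n).some.symm⟩⟩

/-- **`FormalGeometry.GortzWedhorn2023_prop_24_95_wittModel_liftsTo_of_liftsFormally` is a theorem**
(Görtz–Wedhorn II Prop. 24.95, essential surjectivity, on smooth proper `W(k)`-models, every universe:
`LiftsFormally 𝒳 E₁ → LiftsTo 𝒳 E₁`): the `Motives` form of the web implies it
(`GrothendieckExistence_vectorBundle_witt.prop_24_95_wittModel`), and that form holds
(`GrothendieckExistence_vectorBundle_witt_holds`). -/
theorem GortzWedhorn2023_prop_24_95_wittModel_liftsTo_of_liftsFormally_holds :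
    Literature.AlgebraicGeometry.FormalGeometry.GortzWedhorn2023_prop_24_95_wittModel_liftsTo_of_liftsFormally.{u} :=
  GrothendieckExistence_vectorBundle_witt.prop_24_95_wittModel
    GrothendieckExistence_vectorBundle_witt_holds.{u}

end GrothendieckExistenceProper

end Summit.HodgeConjecture.HodgeConjecture.Theorems

end
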